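import Literature.AnabelianGeometry.EtaleTheta.Discharge.Sec3Example39DataNonVacuity
import Literature.AnabelianGeometry.EtaleTheta.Discharge.Sec3Cor38CriterionToy
import Literature.AnabelianGeometry.EtaleTheta.TemperedFrobenioidProps
import Literature.AnabelianGeometry.EtaleTheta.Discharge.Sec4Model
import Literature.AlgebraicGeometry.Frobenioids.ModelFrobenioidIsFrobenioid
import Literature.AlgebraicGeometry.Frobenioids.PadicFrobenioidQpSplit

/-!
# [EtTh] Def. 3.6 (ii) / Cor. 3.8: a tempered Frobenioid over the tree's GENUINE [FrdI] vocabularies,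
# which IS a Frobenioid, and an inhabitant of `Cor38Hyp` (non-vacuity witnesses)

S. Mochizuki, *The étale theta function and its Frobenioid-theoretic manifestations*, Publ. RIMS **45**
(2009) [MochizukiEtTh2009], Def. 3.6 (ii) pp. 76–77 (printed 302–303), Cor. 3.8 p. 80; S. Mochizuki,
*The geometry of Frobenioids I* [MochizukiFrdI2008], Thm. 5.2 (ii) p. 100 (model Frobenioids are
Frobenioids).

abc-iut cell, layer L2, ROW «NV-L2/Example39Data (+ Cor38Hyp cross-check)» (abc-iut-L2-lead gen 3,
RULINGS #5 (R47); seat abc-iut-w5-d164 gen 3), continuation of `Discharge/Sec3Example39DataNonVacuity.lean`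
(p424615).  abc-iut-L2-t3's `Toy.temperedFrobenioid` (`TemperedFrobenioidToy.lean`) inhabits
`TemperedFrobenioid` over the ALL-`True` vocabularies `Toy.monoidVocab` / `Toy.catVocab` and carries no
Frobenioid certificate; abc-iut-w5-d124's Cor. 3.8 criterion files (`Sec3Cor38Criterion*.lean`) are
`∀`-statements over `C : TemperedFrobenioid T D VD` + `hF : PreFrobenioid.IsFrobenioid C.toElem` with no
instantiation target (their `Cor38Toy.C`, p425444, is an `ℤ_{≥0}³`-toy over the all-`True` vocabularies built to
REFUTE the bare typed row C38-L05); abc-iut-w5-d197's census lists `Cor38Hyp` with ZERO producers.  THIS FILE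
(model-construction file, «post-freeze class (b)»: new path, nothing frozen edited) builds:

* `Toy.genuineTemperedFrobenioid R S : TemperedFrobenioid (ofRlfZ Toy.divisorMonoids _) (Discrete PUnit)
  (treeCatVocab (Discrete PUnit) R S)` — Def. 3.6 (ii) data over the GENUINE monoid vocabulary
  `treeMonoidVocab` (carried by abc-iut-L6-t12's constructor `ofRlfZ`: `Φ^{ℝ-log} = ℕ^rlf`, the real
  realification) and the GENUINE category vocabulary `treeCatVocab` ("divisorial monoid on `D`" =
  `IsMonoidOn ∧` objectwise `IsDivisorial`; the two [FrdI] Def. 4.5 predicates `R`, `S` stay parameters, as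
  in `FrdIVocabulary.lean`), with `Φ := im(Φ₀^pf → Φ₀^rlf) ≅ ℚ_{≥0}` (group-saturated and perf-factorial by
  the generic lemmas of p424615; divisorial = monoprime; `Φ^{bs-fld} = Φ` monoprime since every divisor is
  base-field-theoretic at the toy — `F₀ = B₀`; (b) the constant `𝔭 ∈ F₀` has divisor `ι(1)/1`, `ι(1) ≠ 1`);
* **`Toy.isFrobenioid_genuineTemperedFrobenioid : PreFrobenioid.IsFrobenioid (…).toElem`** — the
  resulting model-Frobenioid category IS a Frobenioid ([FrdI] Thm. 5.2 (ii), abc-iut-found's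
  `ModelFrobenioid.isFrobenioid`: `Φ`, `B` monoids on the one-object base — every pull-back is along an
  identity —, `Φ` divisorial, `B` group-like (abc-iut-L6-d1's `isGroupLike_ratFnFunctor`), `D` connected and
  totally epimorphic): the first CONSTRUCTED tempered Frobenioid in the tree carrying `hF`;
* `Toy.nonempty_cor38Hyp_genuine : Nonempty (Cor38Hyp C C)` for that `C` (`Ψ := 𝟭`, `D` of FSM-type hence
  of FSMFF-type, `Φ` non-dilating under the identities).

HONEST LABEL: GENUINE vocabularies / realification / [FrdI] predicates / Frobenioid certificate;
DEGENERATE geometry — one object, one prime, `Λ = ℤ`, all functions constant (`F₀ = B₀ = 𝔭^ℤ`).  A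
consistency and instantiation witness; NOT the tempered Frobenioid of a curve; nothing here bears on
[IUTchIII] Cor. 3.12.  Typed ≠ proved.
-/

noncomputable section

namespace Literature.AnabelianGeometry.EtaleTheta

open CategoryTheory Opposite Literature.AlgebraicGeometry.Frobenioids

namespace Toy

open Example39NV

/-! ### The genuine-vocabulary realified data at the toy and the divisor monoid `Φ := im(Φ₀^pf → Φ₀^rlf)` -/

/-- The Def. 3.6 (i) realified data CONSTRUCTED from the toy Def. 3.3 (iii) data over the genuine monoid
vocabulary: abc-iut-L6-t12's `ofRlfZ` at `Toy.divisorMonoids` (`Φ₀ = ℕ`, `Φ₀^ℝ = ℕ^rlf`, `B₀^ℤ = B₀ = ℤ`,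
`F₀^ℤ = F₀ = ⊤`, `ℝ·Φ₀^cnst =` the genuine `ℝ`-span). [cite: MochizukiEtTh2009, Def 3.6 p.76] -/
abbrev realifiedGenuine : RealifiedDivisorMonoids (D₀ := Discrete PUnit.{1}) treeMonoidVocab.{0} :=
  RealifiedDivisorMonoids.ofRlfZ divisorMonoids isPerfFactorial_Φ₀

/-- `Φ₀(Y) = ℕ` of the toy data is monoprime (read on the carrier of `Φ₀(Y)`). [cite: MochizukiEtTh2009, Prop 3.4 p.74] -/
theorem isMonoprime_Φ₀ (Y : (Discrete PUnit.{1})ᵒᵖ) : IsMonoprime (divisorMonoids.Φ₀.obj Y) :=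
  isMonoprime_multiplicative_nat

/-- `div₀` of the toy data on the non-negative integers: `div₀(k) = 𝔭^k = of (ofAdd k)`.
[cite: MochizukiEtTh2009, Def 3.3 p.73] -/
theorem divHom_ofAdd_natCast (k : ℕ) :
    divHom (Multiplicative.ofAdd (k : ℤ)) = Algebra.GrothendieckGroup.of (Multiplicative.ofAdd k) := by
  rw [divHom, zpowersHom_apply, toAdd_ofAdd, zpow_natCast, ← map_pow, ← ofAdd_nsmul, smul_eq_mul, mul_one]

/-- Every element of `Φ₀(Y)^gp` coming from `Φ₀(Y) = ℕ` is the divisor of a (constant) function: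
`of m = div₀ (ofAdd (toAdd m))`. [cite: MochizukiEtTh2009, Def 3.3 p.73] -/
theorem divHom_ofAdd_toAdd (m : Multiplicative ℕ) :
    divHom (Multiplicative.ofAdd ((Multiplicative.toAdd m : ℕ) : ℤ)) = Algebra.GrothendieckGroup.of m := by
  rw [divHom_ofAdd_natCast, ofAdd_toAdd]

/-- `Φ(Y) := im(Φ₀(Y)^pf → Φ₀(Y)^rlf) ⊆ Φ^{ℝ-log}(Y)` — print's "`Φ_W` … the perfection of `Φ₀`" read inside
the realification. [cite: MochizukiEtTh2009, Def 3.6 p.76] -/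
def pfImage (Y : (Discrete PUnit.{1})ᵒᵖ) : Submonoid (realifiedGenuine.ΦR.obj Y) :=
  MonoidHom.mrange (isPerfFactorial_Φ₀ Y).toRealification

/-- Membership in `Φ(Y)`. [cite: MochizukiEtTh2009, Def 3.6 p.76] -/
theorem mem_pfImage_iff (Y : (Discrete PUnit.{1})ᵒᵖ) (x : realifiedGenuine.ΦR.obj Y) :
    x ∈ pfImage Y ↔ ∃ a, (isPerfFactorial_Φ₀ Y).toRealification a = x := Iff.rfl

/-- `Φ(Y)` is monoprime (`≅ ℕ^pf ≅ ℚ_{≥0}`). [cite: MochizukiEtTh2009, Def 3.6 p.77] -/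
theorem isMonoprime_pfImage (Y : (Discrete PUnit.{1})ᵒᵖ) : IsMonoprime ↥(pfImage Y) :=
  isMonoprime_mrange_toRealification (isMonoprime_Φ₀ Y)

/-- Every element of `(Φ^{ℝ-log})^gp(Y)` coming from `Φ(Y)` lies in `ℝ·Φ₀^cnst(Y)`: at the toy every
log-meromorphic function is constant (`F₀ = B₀`) and every element of `Φ₀(Y)^gp` is a divisor `div₀(b)`,
so the image of `Φ₀` is base-field-theoretic (`Φ₀^cnst ⊆ ℝ·Φ₀^cnst`), and `ℝ·Φ₀^cnst` is root-closed, so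
the image of `Φ₀^pf` is too. [cite: MochizukiEtTh2009, Def 3.6 p.77] -/
theorem of_mem_cnstR_of_mem_pfImage (Y : (Discrete PUnit.{1})ᵒᵖ) {x : realifiedGenuine.ΦR.obj Y}
    (hx : x ∈ pfImage Y) : Algebra.GrothendieckGroup.of x ∈ realifiedGenuine.cnstR Y := by
  obtain ⟨a, rfl⟩ := hx
  obtain ⟨⟨m, n⟩, rfl⟩ := Perfection.mk_surjective a
  -- the `n`-th power of the class is the class of `ι(of m)`
  apply realifiedGenuine.mem_cnstR_of_pow_mem Y n.ne_zero
  rw [← map_pow, ← map_pow, Perfection.mk_pow_self]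
  -- `of m = div₀ (ofAdd (toAdd m))` is the divisor of a (constant) function, so its image lies in `ℝ·Φ₀^cnst`;
  -- and `of (ι (of m)) = gpMap (Φ₀ → Φ₀^ℝ) (of m)`
  have key : EtaleTheta.gpMap (realifiedGenuine.toR Y) (realifiedGenuine.div₀ Y
      (Multiplicative.ofAdd ((Multiplicative.toAdd (show Multiplicative ℕ from m) : ℕ) : ℤ))) ∈
      realifiedGenuine.cnstR Y :=
    realifiedGenuine.cnst_le_cnstR Y _ (Submonoid.mem_top _)
  have hb : realifiedGenuine.div₀ Y
      (Multiplicative.ofAdd ((Multiplicative.toAdd (show Multiplicative ℕ from m) : ℕ) : ℤ)) =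
      (Algebra.GrothendieckGroup.of m : Algebra.GrothendieckGroup (realifiedGenuine.Φ₀.obj Y)) :=
    divHom_ofAdd_toAdd (show Multiplicative ℕ from m)
  rw [hb, EtaleTheta.gpMap_of] at key
  exact key

/-- Hence `Φ(Y) ∩ (ℝ·Φ₀^cnst)(Y) = Φ(Y)` ("`Φ^{bs-fld} = Φ`" at the toy). [cite: MochizukiEtTh2009, Def 3.6 p.77] -/
theorem pfImage_inf_cnstR_eq (Y : (Discrete PUnit.{1})ᵒᵖ) :
    pfImage Y ⊓ (realifiedGenuine.cnstR Y).toSubmonoid.comap Algebra.GrothendieckGroup.of = pfImage Y :=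
  inf_eq_left.mpr fun _ hx => of_mem_cnstR_of_mem_pfImage Y hx

/-- The generator `ι(𝔭) = ι(of 1) ∈ Φ(Y)` is not `1` (`ℕ^pf ↪ ℕ^rlf`, and `ℕ` is sharp).
[cite: MochizukiEtTh2009, Def 3.6 p.77] -/
theorem toRealification_of_ofAdd_one_ne_one (Y : (Discrete PUnit.{1})ᵒᵖ) :
    (isPerfFactorial_Φ₀ Y).toRealification (Perfection.of _ (Multiplicative.ofAdd (1 : ℕ))) ≠ 1 := by
  intro h
  have h1 := toRealification_injective (isPerfFactorial_Φ₀ Y) (h.trans (map_one _).symm)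
  rw [Perfection.of_apply,
    Perfection.mk_eq_one_iff_of_isSharp (MonoprimeStructure.isSharp (isMonoprime_Φ₀ Y))] at h1
  have h2 : (Multiplicative.ofAdd (1 : ℕ) : Multiplicative ℕ) = 1 := h1
  exact one_ne_zero (ofAdd_eq_one.mp h2)

/-! ### The divisor monoid as a subfunctor and the tempered Frobenioid -/

/-- `Φ ⊆ Φ^{ℝ-log} := Φ₀^ℝ|_D` over the identity base functor: `A ↦ im(Φ₀^pf → Φ₀^rlf)`, stable under
pull-back (`Φ₀(f)^rlf ∘ ι = ι ∘ Φ₀(f)^pf`, abc-iut-L2-d2). [cite: MochizukiEtTh2009, Def 3.6 p.76] -/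
def genuineΦ : SubMonoidOn ((𝟭 (Discrete PUnit.{1})).op ⋙ realifiedGenuine.ΦR) where
  carrier A := pfImage A
  map_mem := by
    rintro A B f _ ⟨a, rfl⟩
    refine ⟨Perfection.map (divisorMonoids.Φ₀.map f).hom a, ?_⟩
    have h := DFunLike.congr_fun (rlfMap_comp_toRealification divisorMonoids.Φ₀ isPerfFactorial_Φ₀ f) a
    simp only [MonoidHom.comp_apply] at h
    exact h.symm

/-- `Φ(A)` is `pfImage A`. [cite: MochizukiEtTh2009, Def 3.6 p.76] -/
@[simp] theorem genuineΦ_carrier (A : (Discrete PUnit.{1})ᵒᵖ) : genuineΦ.carrier A = pfImage A := rfl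

variable (R S : ((Discrete PUnit.{1})ᵒᵖ ⥤ CommMonCat.{0}) → Prop)

/-- **Def. 3.6 (ii) data over the GENUINE vocabularies** — the tempered Frobenioid structure on
`(D := Discrete PUnit → D₀, Φ := im(Φ₀^pf → Φ₀^rlf))` over `ofRlfZ Toy.divisorMonoids`: `D` connected and
totally epimorphic; `Φ` group-saturated in `Φ^{ℝ-log}` and perf-factorial (generic lemmas of p424615),
a divisorial monoid on `D` in the TREE's sense (`IsMonoidOn` ∧ objectwise `IsDivisorial`: monoprime ⇒
divisorial); (a) `Φ^{bs-fld} = Φ` monoprime; (b) `𝔭 ∈ F₀` has divisor `ι(1)/1 ≠ 1`.  `R`, `S` = the [FrdI]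
Def. 4.5 predicates, parameters as in `treeCatVocab`. [cite: MochizukiEtTh2009, Def 3.6 p.77] -/
def genuineTemperedFrobenioid :
    TemperedFrobenioid realifiedGenuine (Discrete PUnit.{1}) (treeCatVocab (Discrete PUnit.{1}) R S) where
  isConnected := temperedFrobenioid.isConnected
  isTotallyEpimorphic := temperedFrobenioid.isTotallyEpimorphic
  base := 𝟭 _
  Φ := genuineΦ
  isGroupSaturated A := isGroupSaturated_mrange_toRealification (isPerfFactorial_Φ₀ A)
  isPerfFactorial A := isPerfFactorial_mrange_toRealification (isMonoprime_Φ₀ A)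
  isDivisorialOn := by
    rw [treeCatVocab_isDivisorialOn]
    exact ⟨Cor38Toy.isMonoidOn_of_punit _, fun A => MonoprimeStructure.isDivisorial (isMonoprime_pfImage (op A))⟩
  isMonoprime_bsFld A :=
    IsMonoprime.of_mulEquiv (MulEquiv.submonoidCongr (pfImage_inf_cnstR_eq A).symm) (isMonoprime_pfImage A)
  exists_FΛ_div_ne A := by
    refine ⟨Multiplicative.ofAdd (1 : ℤ), Submonoid.mem_top _,
      (isPerfFactorial_Φ₀ A).toRealification (Perfection.of _ (Multiplicative.ofAdd (1 : ℕ))),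
      ⟨_, rfl⟩, 1, one_mem _, toRealification_of_ofAdd_one_ne_one A, ?_⟩
    show EtaleTheta.gpMap (realifiedGenuine.toR A) (divHom (Multiplicative.ofAdd (1 : ℤ))) = _
    simp only [map_one, div_one]
    exact (congrArg (EtaleTheta.gpMap (realifiedGenuine.toR A)) divHom_ofAdd_one).trans
      (EtaleTheta.gpMap_of _ _)

/-- `Φ` of the genuine toy is `pfImage`. [cite: MochizukiEtTh2009, Def 3.6 p.77] -/
@[simp] theorem genuineTemperedFrobenioid_Φ_carrier (A : (Discrete PUnit.{1})ᵒᵖ) :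
    (genuineTemperedFrobenioid R S).Φ.carrier A = pfImage A := rfl

/-- The base functor of the genuine toy is the identity. [cite: MochizukiEtTh2009, Def 3.6 p.77] -/
@[simp] theorem genuineTemperedFrobenioid_base : (genuineTemperedFrobenioid R S).base = 𝟭 _ := rfl

/-! ### The resulting model Frobenioid IS a Frobenioid ([FrdI] Thm. 5.2 (ii)) -/

/-- **The genuine toy tempered Frobenioid is a Frobenioid**: `hF` for
`(Toy.genuineTemperedFrobenioid R S).toElem`, by [FrdI] Thm. 5.2 (ii) (abc-iut-found's
`ModelFrobenioid.isFrobenioid`) — `Φ` and `B` are monoids on the one-object base (pull-backs along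
identities), `Φ` is divisorial, `B` is group-like (`isGroupLike_ratFnFunctor` from `B₀^Λ` group-like), `D`
is connected and totally epimorphic. [cite: MochizukiFrdI2008, Thm. 5.2(ii) p.100] -/
theorem isFrobenioid_genuineTemperedFrobenioid :
    PreFrobenioid.IsFrobenioid (genuineTemperedFrobenioid R S).toElem :=
  ModelFrobenioid.isFrobenioid
    (Cor38Toy.isMonoidOn_of_punit _)
    (fun A => MonoprimeStructure.isDivisorial (isMonoprime_pfImage (op A)))
    (Cor38Toy.isMonoidOn_of_punit _)
    ((genuineTemperedFrobenioid R S).isGroupLike_ratFnFunctor realifiedGenuine.isUnit_BΛ)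
    (isGraphConnected_iff_isConnected.mpr (genuineTemperedFrobenioid R S).isConnected)
    (genuineTemperedFrobenioid R S).isTotallyEpimorphic

/-! ### Corollary 3.8's standing hypotheses are inhabited -/

/-- `Φ` of the genuine toy is non-dilating under the endomorphisms of the base (identities).
[cite: MochizukiEtTh2009, Cor 3.8 p.80] -/
theorem genuineTemperedFrobenioid_nonDilating (A : (Discrete PUnit.{1})ᵒᵖ) (f : A ⟶ A) :
    treeMonoidVocab.IsNonDilating _ ((genuineTemperedFrobenioid R S).Φ.pull f) := by
  have hf : f = 𝟙 A := Quiver.Hom.unop_inj (Subsingleton.elim _ _)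
  subst hf
  rw [treeMonoidVocab_isNonDilating]
  have hpull : (genuineTemperedFrobenioid R S).Φ.pull (𝟙 A) = MonoidHom.id _ := by
    ext x
    rw [SubMonoidOn.coe_pull, CategoryTheory.Functor.map_id, MonoidHom.id_apply]
    rfl
  rw [hpull]
  exact isNonDilating_id

/-- **`Cor38Hyp` is inhabited**: for `C₁ = C₂ :=` the genuine toy tempered Frobenioid and `Ψ := 𝟭`, the
standing hypotheses of [EtTh] Cor. 3.8 ("`D_i` of FSMFF-type, `Φ_i` non-dilating, `Ψ : C₁ ≅ C₂` an
equivalence") hold — `D` is of FSM-type hence of FSMFF-type ([FrdI] §0 p. 18). A consistency witness only.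
[cite: MochizukiEtTh2009, Cor 3.8 p.80] -/
theorem nonempty_cor38Hyp_genuine :
    Nonempty (Cor38Hyp (genuineTemperedFrobenioid R S) (genuineTemperedFrobenioid R S)) :=
  ⟨{ Ψ := CategoryTheory.Equivalence.refl
     fsmff := ⟨PadicFrd.isOfFSMType_discretePUnit.isOfFSMFFType, PadicFrd.isOfFSMType_discretePUnit.isOfFSMFFType⟩
     nonDilating := ⟨genuineTemperedFrobenioid_nonDilating R S, genuineTemperedFrobenioid_nonDilating R S⟩ }⟩

end Toy

end Literature.AnabelianGeometry.EtaleTheta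

end
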